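import Summits.CriticalPhenomena.PercolationContinuityZ3.Theorems.PercNearOneGluingNoHeavyPcintChordMem
import HarnessLib

/-!
# PCINT lane, reduction B3r (`chordrand_cw`) on the memory-`τ` DANGEROUS-SET automaton — per-word domination and the glue

Cell `prim-pcint` (PAPER-2 track (iii): certified intervals for `p_c(ℤ^d)`), seat `prim-pcint-2` (gen 4); support file
(`--supports stmt-CriticalPhenomena-4575`).  Does NOT build on p205010.  Memo: `run/shared/lean/prim/pcint/REDUCTIONS.md`
§B3r.1–2, §B3r.8, §R2.3–R2.5.

For a self-avoiding word `γ` of length `n` the full B3r weight `chordRandWeight p s γ` (`…PcintChordRandReduction`) is at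
most the run weight of the dangerous-set automaton `chordMemAut τ p ((1-p)·r) s̄ κ̄` of `…PcintChordMem` from the empty state
(`chordRandWeight_le_run`): per step the gap/corner factors are dominated (`gapFactor_mul_le_bwt`), and the on-path
charges are paid by the refunds `r ≥ 1/s` of the detected chords and by the slack `(1-p) ≤ s²` of the undetected ones
(`card_onEventsR_le`, `sum_remChordTrue_eq`, `bchord_le_remChordTrue`).  Summing over `SAW_n` gives
`Σ chordRandWeight ≤ total n ∅` and the glue **`le_criticalProb_zd_of_chordMem_total`**: a geometric bound `total n ∅ ≤ C λⁿ`,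
`λ < 1`, certifies `p ≤ p_c^bond(ℤ^d)`.  The symmetry quotient and the kernel arithmetic that produce such a bound from a
finite certificate are in `…PcintChordMemSym` and `…PcintChordMemKernel*`.
-/

noncomputable section

namespace Summit.CriticalPhenomena.PercolationContinuityZ3.Theorems.Pcint

open Finset Literature.Probability.Percolation Literature.Probability.LatticeModels

variable {d : ℕ} (a₀ : Fin d × Bool) {τ n : ℕ} {γ : Fin n → Fin d × Bool}

include a₀ in
/-- **Per-word domination** (REDUCTIONS §B3r.2/§B3r.8 with "remembered set" for "window"): for a self-avoiding word, the
B3r weight is at most the run weight of `chordMemAut τ p ((1-p) r) s̄ κ̄` from the empty dangerous set, whenever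
`0 < s ≤ s̄ ≤ 1`, `s² ≥ 1 - p²`, `(1+s̄)/2 ≤ κ̄`, `r ≥ 0`, `s·r ≥ 1`, `(1-p)·r ≤ 1`. [folklore] -/
theorem chordRandWeight_le_run (hτ : 2 ≤ τ) (hs : IsSAW γ) (p : unitInterval) {s sb κb r : ℝ}
    (hs0 : 0 < s) (hsb : s ≤ sb) (hsb1 : sb ≤ 1) (hκb : (1 + sb) / 2 ≤ κb) (hps : 1 - (p : ℝ) ^ 2 ≤ s ^ 2)
    (hr0 : 0 ≤ r) (hsr : 1 ≤ s * r) (hpr : (1 - (p : ℝ)) * r ≤ 1) :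
    chordRandWeight p s γ ≤
      (chordMemAut τ p ((1 - p) * r) sb κb p.2.1 (mul_nonneg (sub_nonneg.2 p.2.2) hr0) (hs0.le.trans hsb)
        (by linarith)).run n ∅ γ := by
  classical
  have hp0 : (0 : ℝ) ≤ p := p.2.1
  have hp1 : (p : ℝ) ≤ 1 := p.2.2
  have hq0 : 0 ≤ 1 - (p : ℝ) := sub_nonneg.2 hp1
  have hsb0 : 0 ≤ sb := hs0.le.trans hsb
  have hs1 : s ≤ 1 := hsb.trans hsb1
  have hκ0 : (0 : ℝ) ≤ (1 + s) / 2 := by linarith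
  have hκ1 : (1 + s) / 2 ≤ 1 := by linarith
  have hκb0 : 0 ≤ κb := by linarith
  have hpr0 : 0 ≤ (1 - (p : ℝ)) * r := mul_nonneg hq0 hr0
  have hps' : 1 - (p : ℝ) ≤ s ^ 2 := by nlinarith
  set M := chordMemAut (d := d) τ p ((1 - p) * r) sb κb hp0 hpr0 hsb0 hκb0 with hM
  -- the run follows the dangerous sets
  have hrun := M.run_eq_prod_of_states n (fun t => danger τ (pre a₀ γ t)) γ (fun t ht => by
    rw [hM]; exact mstep_danger_pre a₀ hτ hs ht)
  rw [danger_zero τ _] at hrun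
  rw [hrun, chordRandWeight_eq_prod, prod_range_succ' _ n, gapFactor_zero, mul_one]
  have hwt : ∀ (t : ℕ) (ht : t < n), M.wt (danger τ (pre a₀ γ t)) (γ ⟨t, ht⟩) =
      (p : ℝ) * (((1 - p) * r) ^ bchord (danger τ (pre a₀ γ t)) (γ ⟨t, ht⟩) *
        (sb ^ bgap (danger τ (pre a₀ γ t)) (γ ⟨t, ht⟩) *
          (if bcorner (danger τ (pre a₀ γ t)) (γ ⟨t, ht⟩) then κb else 1))) := fun t ht => by rw [hM]; rfl
  -- notation
  set CV := ∑ t ∈ range n, remChordTrue τ γ t with hCV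
  set E := (onEventsR τ γ).card with hE
  have hCVeq : CV = (visChordsR τ γ).card := sum_remChordTrue_eq τ γ
  have hEle : E ≤ CV + 2 * (invChordsR τ γ).card := by rw [hCVeq]; exact card_onEventsR_le τ γ
  have hCH : CV + (invChordsR τ γ).card = (chordEdges γ).card := by
    rw [hCVeq, ← IsSAW.card_chordPairs_eq hs]; exact card_visChordsR_add_card_invChordsR τ γ
  -- (1) chords and on-path events
  have hchords : (1 - (p : ℝ)) ^ (chordEdges γ).card * s ^ CV ≤ (1 - (p : ℝ)) ^ CV * s ^ E := by
    rw [← hCH, pow_add]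
    calc (1 - (p : ℝ)) ^ CV * (1 - (p : ℝ)) ^ (invChordsR τ γ).card * s ^ CV
        ≤ (1 - (p : ℝ)) ^ CV * (s ^ 2) ^ (invChordsR τ γ).card * s ^ CV :=
          mul_le_mul_of_nonneg_right (mul_le_mul_of_nonneg_left (pow_le_pow_left₀ hq0 hps' _) (pow_nonneg hq0 _))
            (pow_nonneg hs0.le _)
      _ = (1 - (p : ℝ)) ^ CV * s ^ (CV + 2 * (invChordsR τ γ).card) := by rw [← pow_mul, pow_add]; ring
      _ ≤ (1 - (p : ℝ)) ^ CV * s ^ E :=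
          mul_le_mul_of_nonneg_left (pow_le_pow_of_le_one hs0.le hs1 hEle) (pow_nonneg hq0 _)
  -- (2) gap/corner factors and on-path events, step by step
  have hE_fib : E = ∑ t ∈ range n, ((onEventsR τ γ).filter fun th => th.1 = t).card := by
    rw [hE]
    exact card_eq_sum_card_fiberwise fun th hth => by
      rw [mem_coe, mem_range]; exact (mem_onEventsR.1 hth).1
  have hsteps : (∏ t ∈ range n, gapFactor s ((1 + s) / 2) γ (t + 1)) * s ^ E ≤
      ∏ t ∈ range n, (if ht : t < n then (sb ^ bgap (danger τ (pre a₀ γ t)) (γ ⟨t, ht⟩) *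
        (if bcorner (danger τ (pre a₀ γ t)) (γ ⟨t, ht⟩) then κb else 1)) else 1) := by
    rw [hE_fib, ← prod_pow_eq_pow_sum, ← prod_mul_distrib]
    refine prod_le_prod (fun t _ => mul_nonneg (gapFactor_nonneg hs0.le hκ0 γ _) (pow_nonneg hs0.le _))
      fun t ht => ?_
    have ht' := mem_range.1 ht
    rw [dif_pos ht']
    exact gapFactor_mul_le_bwt a₀ hτ ht' hs0.le hsb hsb1 hκb
  -- (3) the refunds of the detected chords
  set A := ∏ t ∈ range n, (if ht : t < n then ((1 - (p : ℝ)) * r) ^ bchord (danger τ (pre a₀ γ t)) (γ ⟨t, ht⟩)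
    else 1) with hA
  set B := ∏ t ∈ range n, (if ht : t < n then (sb ^ bgap (danger τ (pre a₀ γ t)) (γ ⟨t, ht⟩) *
    (if bcorner (danger τ (pre a₀ γ t)) (γ ⟨t, ht⟩) then κb else 1)) else 1) with hB
  have hA0 : 0 ≤ A := prod_nonneg fun t _ => by split_ifs <;> positivity
  have hrefund : (1 - (p : ℝ)) ^ CV ≤ A * s ^ CV := by
    have h1 : (∏ t ∈ range n, ((1 - (p : ℝ)) * r) ^ remChordTrue τ γ t) ≤ A := by
      refine prod_le_prod (fun t _ => pow_nonneg hpr0 _) fun t ht => ?_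
      rw [dif_pos (mem_range.1 ht)]
      exact pow_le_pow_of_le_one hpr0 hpr (bchord_le_remChordTrue a₀ (mem_range.1 ht))
    have h2 : (∏ t ∈ range n, ((1 - (p : ℝ)) * r) ^ remChordTrue τ γ t) * s ^ CV =
        (1 - (p : ℝ)) ^ CV * (r * s) ^ CV := by
      rw [prod_pow_eq_pow_sum, ← hCV, mul_pow, mul_pow]; ring
    have h3 : (1 : ℝ) ≤ (r * s) ^ CV := one_le_pow₀ (by rw [mul_comm]; exact hsr)
    calc (1 - (p : ℝ)) ^ CV ≤ (1 - (p : ℝ)) ^ CV * (r * s) ^ CV := le_mul_of_one_le_right (pow_nonneg hq0 _) h3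
      _ = _ := h2.symm
      _ ≤ A * s ^ CV := mul_le_mul_of_nonneg_right h1 (pow_nonneg hs0.le _)
  -- the product of the automaton weights, split
  have hprod : (∏ t ∈ range n, if ht : t < n then M.wt (danger τ (pre a₀ γ t)) (γ ⟨t, ht⟩) else 1) =
      (p : ℝ) ^ n * (A * B) := by
    have hpn : (p : ℝ) ^ n = ∏ _t ∈ range n, (p : ℝ) := by rw [prod_const, card_range]
    rw [hpn, hA, hB, ← prod_mul_distrib, ← prod_mul_distrib]
    refine prod_congr rfl fun t ht => ?_
    have ht' := mem_range.1 ht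
    rw [dif_pos ht', dif_pos ht', dif_pos ht', hwt t ht']
  set Pk := ∏ t ∈ range n, gapFactor s ((1 + s) / 2) γ (t + 1) with hPkdef
  have hPk : 0 ≤ Pk := prod_nonneg fun T _ => gapFactor_nonneg hs0.le hκ0 γ _
  have hsCV : 0 < s ^ CV := pow_pos hs0 _
  have hkey : (1 - (p : ℝ)) ^ (chordEdges γ).card * Pk ≤ A * B := by
    have h1 : (1 - (p : ℝ)) ^ (chordEdges γ).card * Pk * s ^ CV ≤ A * B * s ^ CV := by
      calc (1 - (p : ℝ)) ^ (chordEdges γ).card * Pk * s ^ CV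
          = ((1 - (p : ℝ)) ^ (chordEdges γ).card * s ^ CV) * Pk := by ring
        _ ≤ ((1 - (p : ℝ)) ^ CV * s ^ E) * Pk := mul_le_mul_of_nonneg_right hchords hPk
        _ = (1 - (p : ℝ)) ^ CV * (Pk * s ^ E) := by ring
        _ ≤ (A * s ^ CV) * B := mul_le_mul hrefund hsteps (mul_nonneg hPk (pow_nonneg hs0.le _))
            (mul_nonneg hA0 (pow_nonneg hs0.le _))
        _ = A * B * s ^ CV := by ring
    exact le_of_mul_le_mul_right h1 hsCV
  rw [hprod]
  calc (p : ℝ) ^ n * (1 - (p : ℝ)) ^ (chordEdges γ).card * Pk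
      = (p : ℝ) ^ n * ((1 - (p : ℝ)) ^ (chordEdges γ).card * Pk) := by ring
    _ ≤ (p : ℝ) ^ n * (A * B) := mul_le_mul_of_nonneg_left hkey (pow_nonneg hp0 _)

include a₀ in
/-- **Sum form**: `Σ_{γ ∈ SAW_n} chordRandWeight p s γ ≤ total n ∅` for the dangerous-set B3r automaton. [folklore] -/
theorem sum_chordRandWeight_le_total (hτ : 2 ≤ τ) (p : unitInterval) {s sb κb r : ℝ}
    (hs0 : 0 < s) (hsb : s ≤ sb) (hsb1 : sb ≤ 1) (hκb : (1 + sb) / 2 ≤ κb) (hps : 1 - (p : ℝ) ^ 2 ≤ s ^ 2)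
    (hr0 : 0 ≤ r) (hsr : 1 ≤ s * r) (hpr : (1 - (p : ℝ)) * r ≤ 1) (n : ℕ) :
    ∑ γ ∈ sawWords d n, chordRandWeight p s γ ≤
      (chordMemAut τ p ((1 - p) * r) sb κb p.2.1 (mul_nonneg (sub_nonneg.2 p.2.2) hr0) (hs0.le.trans hsb)
        (by linarith)).total n (∅ : MState d) := by
  classical
  set M := chordMemAut (d := d) τ p ((1 - p) * r) sb κb p.2.1 (mul_nonneg (sub_nonneg.2 p.2.2) hr0)
    (hs0.le.trans hsb) (by linarith) with hM
  calc ∑ γ ∈ sawWords d n, chordRandWeight p s γ ≤ ∑ γ ∈ sawWords d n, M.run n ∅ γ :=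
        sum_le_sum fun γ hγ => by
          rw [hM]; exact chordRandWeight_le_run a₀ hτ (mem_sawWords.1 hγ) p hs0 hsb hsb1 hκb hps hr0 hsr hpr
    _ ≤ M.total n ∅ := M.sum_run_le_total n ∅ _

/-! ### The glue: a geometric bound on the totals gives a lower bound on `p_c^bond(ℤ^d)` -/

/-- **Reduced-state B3r certificate ⇒ `p ≤ p_c^bond(ℤ^d)`.**  If the totals of the dangerous-set B3r automaton from the
empty state are geometrically small, `total n ∅ ≤ C λⁿ` with `λ < 1`, for constants `0 < s ≤ s̄ ≤ 1`, `s² ≥ 1 - p²`,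
`(1+s̄)/2 ≤ κ̄`, `r ≥ 0`, `s·r ≥ 1`, `(1-p)·r ≤ 1` and memory `τ ≥ 2`, then `p ≤ p_c^bond(ℤ^d)`. [folklore] -/
theorem le_criticalProb_zd_of_chordMem_total [NeZero d] {τ : ℕ} (hτ : 2 ≤ τ) (p : unitInterval)
    {s sb κb r C lam : ℝ} (hs0 : 0 < s) (hsb : s ≤ sb) (hsb1 : sb ≤ 1) (hκb : (1 + sb) / 2 ≤ κb)
    (hps : 1 - (p : ℝ) ^ 2 ≤ s ^ 2) (hr0 : 0 ≤ r) (hsr : 1 ≤ s * r) (hpr : (1 - (p : ℝ)) * r ≤ 1)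
    (hlam0 : 0 ≤ lam) (hlam1 : lam < 1)
    (htot : ∀ n, (chordMemAut τ p ((1 - p) * r) sb κb p.2.1 (mul_nonneg (sub_nonneg.2 p.2.2) hr0)
      (hs0.le.trans hsb) (by linarith)).total n (∅ : MState d) ≤ C * lam ^ n) :
    (p : ℝ) ≤ criticalProb (zdGraph d) 0 :=
  le_criticalProb_zd_of_chordRand_le_geometric d p hs0.le (hsb.trans hsb1) hps hlam0 hlam1 (C := C) fun n =>
    (sum_chordRandWeight_le_total ((⟨0, NeZero.pos d⟩, true) : Fin d × Bool) hτ p hs0 hsb hsb1 hκb hps hr0 hsr hpr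
      n).trans (htot n)

end Summit.CriticalPhenomena.PercolationContinuityZ3.Theorems.Pcint
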